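import Mathlib
import Literature.MathematicalPhysics.QuantumFieldTheory.PlaquetteRandomClusterDuality
import HarnessLib

/-!
# The cubical dual of `𝕋⁴_L` and the literal self-duality of the plaquette random-cluster model in
# four dimensions (Duncan–Schweinhart, Theorem 18) — PROVED

Twelfth file of the transcription of the Fortuin–Kasteleyn-type ("plaquette random-cluster")
representation of `q`-state Potts lattice gauge theory (companions: `PlaquetteRandomCluster` —
setting, readings (R1)–(R3), (R7) and the SCOPE caveat —, `PlaquetteRandomClusterEulerPoincare`
(Prop. 15), `PlaquetteRandomClusterDuality` (Theorem 18 in the "Alexander-dual dictionary": dual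
`k`-cochains := primal `(d-k)`-chains, `δ• := ∂₃`, open dual cells := closed plaquettes; its
docstring defers "the literal cubical-dual cell identification for `d = 4`, with the signs
`[σ• : τ•] = ±[τ : σ]`" — this file supplies it)).

## Scope (read this first)

Nothing in this file bears on the Clay Yang–Mills mass-gap problem: finite abelian `ℤ_q`
(field-coefficient plaquette random-cluster combinatorics on a finite `4`-torus). In the `ym` ladder
only the conditional finite-`𝕋⁴` rung `BalabanLadder.UV` is closed by any current route;
`BalabanLadder.IR` is untouched. Self-duality at `p_sd = √q/(1+√q)` is the input of the (still
un-typed, named-fact) sharp giant-cycle transition [DuncanSchweinhart2025, Thm. 8]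
(`PlaquetteRandomClusterGiantCycles`); the other inputs (the Graham–Grimmett sharp-threshold theorem
and the DKS-type lemma of §6 there) are not in the tree.

## Source

P. Duncan, B. Schweinhart, *Topological phases in the plaquette random-cluster model and Potts
lattice gauge theory*, CMP **406** (2025), arXiv:2207.08339 [DuncanSchweinhart2025]: §2.2 (the dual
complex of `𝕋^d_N`: the `i`-cell `σ` has a dual `(d-i)`-cell `σ•`, the dual of `𝕋^d_N` is `𝕋^d_N`
shifted by `(½,…,½)`; "`𝕋^{2i}_N` is self-dual"), §4.3 (the dual configuration `ω•`: `σ•` open iff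
`σ` closed; `p* = (1-p)q/((1-p)q+p)`), **Theorem 14** (`b_i(ω) + b•_i(ω•)` bookkeeping) and
**Theorem 18** ("the balanced `i`-dimensional plaquette random-cluster model on `𝕋^{2i}_N` with
parameters `(p, q)` is dual to the balanced model with parameters `(p*, q)`")
[corpus:paper:arxiv-2207.08339 p0009–p0010 (§2.2), p0014–p0016 (Thms 14, 18)].

## What is typed (d = 4, i = 2; transcriber's coordinates, flagged)

Label the dual site `x + (½,½,½,½)` by `x ∈ 𝕋⁴_L`. Then (all maps explicit, all PROVED):
* `Dual4.complPlane` (`{a<b} ↦ {a,b}ᶜ = {l<m}`), `Dual4.tripleOfDir`/`dirOfTriple`/`tripleEquiv`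
  (`n ↦ {n}ᶜ`), the signs `Dual4.faceSign` (incidence sign `s_π(n)` of the `3`-cell `π ∪ {n}` on its
  face in the plane `π`), `Dual4.eps n = (-1)^n`, `Dual4.dualSign π = s_π(m) ε_l` — finite tables on
  `Fin 4`, identities by `decide`;
* `bd₃_apply_four`: `∂₃` on `𝕋⁴_L` in coordinates (the plaquette `(z; π)` is a face of the four
  `3`-cells `(z; π∪{n})`, `(z - e_n; π∪{n})`, `n ∈ πᶜ`, with signs `∓s_π(n)`);
* `dualPlaq : Plaquette 4 L ≃ Plaquette 4 L`, `σ = (z; a<b) ↦ σ• = (z - e_l - e_m; l<m)` (the dual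
  plaquette in dual coordinates); `dualPlaq_dualPlaq`: `σ•• = σ - (1,1,1,1)`;
* `dualCochainEquiv F : C¹(𝕋⁴_L; F) ≃ₗ C₃(𝕋⁴_L; F)` (`Ψ`; the dual edge `(x; n)` is dual to the
  `3`-cell `(x + e_n; {n}ᶜ)`, with the orientation sign `ε_n`);
* **`res_td₁_dualPlaq`** — the cell-level identity `(δθ)(σ•) = t_σ (∂₃Ψθ)(σ)`, `t_σ = ±1`: the
  coboundary of the dual torus is, cell by cell and up to sign, the boundary `∂₃` of the primal one;
* `dualConfig ω = {σ• : σ ∉ ω}` (on the SAME torus), `card_dualConfig`, and the transfer of flatness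
  `mem_flatCochains_dualConfig_iff`/`finrank_flatCochains_dualConfig`: `Z¹(P(ω•); F) ≅ W(ω)` (the
  "dual cocycles" of the companion file), whence **`weight_dualConfig`**:
  `w_{p',q}(ω•) · q^{dim B¹} = dualWeight_{p',q}(ω)` — the companion's dictionary weight IS the
  plaquette random-cluster weight of the dual configuration;
* `dualPullback F` (`Φ`, dual `2`-chains as primal plaquette functions, twisted by `t_σ`),
  `pairing₂_res_td₁_eq` (`⟨δθ, η⟩ = ⟨Φη, ∂₃Ψθ⟩`), `map_twoCycles_dualConfig` (`Φ Z₂(P(ω•)) = K(ω)`),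
  `dualPullback_bd₃` (the third intertwiner `Φ∂₃ = δ₁ ∘ shift ∘ Ψ⁻¹`, DERIVED from `res_td₁_dualPlaq`
  by double duality), `map_bdTwo_dualPullback` (`Φ B₂ = B²`), **`giantTwo_dualConfig`**
  (`b₂(ω•) = b•(ω)`);
* **`duality_selfdual_four`** — Theorem 18 for `𝕋⁴_L` LITERALLY: for `p ∈ (0,1)`, `q > 0` there is
  `C = C(p,q,L) > 0` with `w_{p,q}(ω) (√q)^{b₂(ω•)} = C · w_{p*,q}(ω•) (√q)^{b₂(ω)}` for all `ω`,
  where `w` is the plaquette random-cluster weight of `PlaquetteRandomCluster` and `b₂ = giantTwo`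
  the rank of `H₂(P(·)) → H₂(𝕋⁴_L)`; i.e. the balanced measure at `(p,q)` is the push-forward under
  `ω ↦ ω•` of the balanced measure at `(p*,q)` (normalising constants are finite sums of these
  weights). `-- TODO(general form): i-dimensional cells of 𝕋^{2i}_N for i ≠ 2.`

Everything in this file is PROVED; no named fact is introduced.
-/

open Finset Module

namespace Literature.MathematicalPhysics.QuantumFieldTheory

namespace PlaquetteRC

open LatticeForm

/-! ### The combinatorics of directions in dimension four -/

namespace Dual4

/-- The planes `{a < b}` of `ℤ⁴`. [cite: DuncanSchweinhart2025, §2.2 (the dual complex of 𝕋^{2i}_N)] -/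
abbrev Plane : Type := {p : Fin 4 × Fin 4 // p.1 < p.2}

/-- The `3`-frames `{i < j < k}` of `ℤ⁴`. [cite: DuncanSchweinhart2025, §2.2] -/
abbrev Triple : Type := {t : Fin 4 × Fin 4 × Fin 4 // t.1 < t.2.1 ∧ t.2.1 < t.2.2}

/-- Smaller element of the complement of `{a, b}` in `{0,1,2,3}`. [cite: DuncanSchweinhart2025, §2.2] -/
def complLo (a b : Fin 4) : Fin 4 := if a = 0 then (if b = 1 then 2 else 1) else 0

/-- Larger element of the complement of `{a, b}`. [cite: DuncanSchweinhart2025, §2.2] -/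
def complHi (a b : Fin 4) : Fin 4 := if b = 3 then (if a = 2 then 1 else 2) else 3

/-- `complLo < complHi`. [cite: DuncanSchweinhart2025, §2.2] -/
theorem complLo_lt_complHi : ∀ π : Plane, complLo π.1.1 π.1.2 < complHi π.1.1 π.1.2 := by decide

/-- The complementary plane `{a,b}ᶜ = {l < m}` (the plane of the dual plaquette). [cite: DuncanSchweinhart2025, §2.2 (dual cells)] -/
def complPlane (π : Plane) : Plane := ⟨(complLo π.1.1 π.1.2, complHi π.1.1 π.1.2), complLo_lt_complHi π⟩

/-- Complementation is an involution. [cite: DuncanSchweinhart2025, §2.2] -/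
theorem complPlane_complPlane : ∀ π : Plane, complPlane (complPlane π) = π := by decide

/-- The sorted `3`-frame `{n}ᶜ`. [cite: DuncanSchweinhart2025, §2.2] -/
theorem tripleOfDir_sorted : ∀ n : Fin 4,
    ((if n = 0 then 1 else 0 : Fin 4), (if n ≤ 1 then 2 else 1 : Fin 4), (if n = 3 then 2 else 3 : Fin 4)).1 <
      ((if n = 0 then 1 else 0 : Fin 4), (if n ≤ 1 then 2 else 1 : Fin 4), (if n = 3 then 2 else 3 : Fin 4)).2.1 ∧
    ((if n = 0 then 1 else 0 : Fin 4), (if n ≤ 1 then 2 else 1 : Fin 4), (if n = 3 then 2 else 3 : Fin 4)).2.1 <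
      ((if n = 0 then 1 else 0 : Fin 4), (if n ≤ 1 then 2 else 1 : Fin 4), (if n = 3 then 2 else 3 : Fin 4)).2.2 := by
  decide

/-- The `3`-frame `{n}ᶜ` of the `3`-cell dual to an edge in direction `n`. [cite: DuncanSchweinhart2025, §2.2 (dual cells)] -/
def tripleOfDir (n : Fin 4) : Triple :=
  ⟨((if n = 0 then 1 else 0 : Fin 4), (if n ≤ 1 then 2 else 1 : Fin 4), (if n = 3 then 2 else 3 : Fin 4)),
    tripleOfDir_sorted n⟩

/-- The direction missing from a `3`-frame. [cite: DuncanSchweinhart2025, §2.2] -/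
def dirOfTriple (T : Triple) : Fin 4 :=
  if T.1.1 ≠ 0 then 0 else if T.1.2.1 ≠ 1 then 1 else if T.1.2.2 ≠ 2 then 2 else 3

/-- `dirOfTriple ∘ tripleOfDir = id`. [cite: DuncanSchweinhart2025, §2.2] -/
theorem dirOfTriple_tripleOfDir : ∀ n : Fin 4, dirOfTriple (tripleOfDir n) = n := by decide

/-- `tripleOfDir ∘ dirOfTriple = id`. [cite: DuncanSchweinhart2025, §2.2] -/
theorem tripleOfDir_dirOfTriple : ∀ T : Triple, tripleOfDir (dirOfTriple T) = T := by decide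

/-- Directions `≃` `3`-frames. [cite: DuncanSchweinhart2025, §2.2] -/
def tripleEquiv : Fin 4 ≃ Triple where
  toFun := tripleOfDir
  invFun := dirOfTriple
  left_inv := dirOfTriple_tripleOfDir
  right_inv := tripleOfDir_dirOfTriple

/-- The incidence sign `s_π(n)` of the `3`-cell `π ∪ {n}` on its face in the plane `π = {a<b}`:
`-1` if `a < n < b`, `+1` otherwise. [cite: DuncanSchweinhart2025, §2.1 (∂ of an i-plaquette)] -/
def faceSign (π : Plane) (n : Fin 4) : ℤ := if π.1.1 < n ∧ n < π.1.2 then -1 else 1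

/-- The orientation sign `ε_n = (-1)^n` attached to the dual edge in direction `n`. [cite: DuncanSchweinhart2025, §2.2 (orientation of dual cells)] -/
def eps (n : Fin 4) : ℤ := if n = 0 ∨ n = 2 then 1 else -1

/-- The sign `t_π = s_π(m) ε_l` (`{l<m} = πᶜ`) relating `δ` of the dual complex to `∂₃`. [cite: DuncanSchweinhart2025, §2.2] -/
def dualSign (π : Plane) : ℤ := faceSign π (complHi π.1.1 π.1.2) * eps (complLo π.1.1 π.1.2)

/-- `ε_n² = 1`. [cite: DuncanSchweinhart2025, §2.2] -/
theorem eps_mul_eps : ∀ n : Fin 4, eps n * eps n = 1 := by decide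

/-- The two sign identities behind `δ• = ± ∂₃` on `𝕋⁴`. [cite: DuncanSchweinhart2025, §2.2] -/
theorem dualSign_identities : ∀ π : Plane,
    dualSign π * faceSign π (complHi π.1.1 π.1.2) * eps (complLo π.1.1 π.1.2) = 1 ∧
    dualSign π * faceSign π (complLo π.1.1 π.1.2) * eps (complHi π.1.1 π.1.2) = -1 := by
  decide

end Dual4

/-! ### `∂₃` on `𝕋⁴_L` in coordinates -/

section BdThree

variable {L : ℕ} {F : Type*} [Field F]

open Dual4

/-- Point equations as translations. [folklore] -/
private theorem add_eq_iff_eq_sub_site (y z v : Site 4 L) : y + v = z ↔ y = z - v := eq_sub_iff_add_eq.symm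

variable [NeZero L]

/-- **`∂₃` of a `3`-chain on `𝕋⁴_L`, explicitly**: the plaquette `(z; a<b)` is a face of the four
`3`-cells `(z; a,b,n)`, `(z - e_n; a,b,n)`, `n ∈ {a,b}ᶜ = {l,m}`, with the incidence signs
`∓ s_π(n)`. [cite: DuncanSchweinhart2025, §2.1 (∂ of an i-plaquette)] -/
theorem bd₃_apply_four (w : Cell₃ 4 L → F) (z : Site 4 L) (π : Plane) :
    bd₃ w (z, π) =
      (faceSign π (complLo π.1.1 π.1.2) : F) *
          (w (z - te (complLo π.1.1 π.1.2), tripleOfDir (complHi π.1.1 π.1.2)) -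
            w (z, tripleOfDir (complHi π.1.1 π.1.2))) +
        (faceSign π (complHi π.1.1 π.1.2) : F) *
          (w (z - te (complHi π.1.1 π.1.2), tripleOfDir (complLo π.1.1 π.1.2)) -
            w (z, tripleOfDir (complLo π.1.1 π.1.2))) := by
  classical
  obtain ⟨⟨a, b⟩, hab⟩ := π
  unfold bd₃
  rw [Fintype.sum_prod_type_right, ← tripleEquiv.sum_comp, Fin.sum_univ_four]
  fin_cases a <;> fin_cases b <;> simp (config := {decide := true}) at hab
  all_goals
    simp (config := {decide := true}) [tripleEquiv, tripleOfDir, complLo, complHi, faceSign, td₂,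
      LatticeForm.ext, plaqInd, Prod.mk.injEq, add_eq_iff_eq_sub_site, mul_sub,
      Finset.sum_sub_distrib]
  all_goals ring

end BdThree

/-! ### The dual cell structure of `𝕋⁴_L`: dual plaquettes and dual edges in primal coordinates -/

section DualMaps

variable {L : ℕ}

open Dual4

/-- **The dual plaquette** of `σ = (z; a<b)`: labelling the dual site `x + (½,½,½,½)` by `x`, the
dual `2`-cell of `σ` is the plaquette `(z - e_l - e_m; l<m)` of the dual torus, `{l,m} = {a,b}ᶜ`; as a
self-map of `Plaquette 4 L` this is a bijection. [cite: DuncanSchweinhart2025, §2.2 (the dual complex; 𝕋^{2i}_N is self-dual)] -/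
def dualPlaq : Plaquette 4 L ≃ Plaquette 4 L where
  toFun σ := (σ.1 - te (complLo σ.2.1.1 σ.2.1.2) - te (complHi σ.2.1.1 σ.2.1.2), complPlane σ.2)
  invFun τ := (τ.1 + te τ.2.1.1 + te τ.2.1.2, complPlane τ.2)
  left_inv σ := by
    obtain ⟨z, π⟩ := σ
    refine Prod.ext ?_ (complPlane_complPlane π)
    show z - te (complLo π.1.1 π.1.2) - te (complHi π.1.1 π.1.2) + te (complLo π.1.1 π.1.2) +
      te (complHi π.1.1 π.1.2) = z
    abel
  right_inv τ := by
    obtain ⟨x, π⟩ := τ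
    have h := complPlane_complPlane π
    have h1 : complLo (complPlane π).1.1 (complPlane π).1.2 = π.1.1 := congrArg (fun ρ => ρ.1.1) h
    have h2 : complHi (complPlane π).1.1 (complPlane π).1.2 = π.1.2 := congrArg (fun ρ => ρ.1.2) h
    refine Prod.ext ?_ h
    show x + te π.1.1 + te π.1.2 - te (complLo (complPlane π).1.1 (complPlane π).1.2) -
      te (complHi (complPlane π).1.1 (complPlane π).1.2) = x
    rw [h1, h2]
    abel

/-- `dualPlaq` unfolded. [cite: DuncanSchweinhart2025, §2.2] -/
theorem dualPlaq_apply (z : Site 4 L) (π : Plane) :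
    dualPlaq (z, π) = (z - te (complLo π.1.1 π.1.2) - te (complHi π.1.1 π.1.2), complPlane π) := rfl

variable (F : Type*) [Field F]

/-- `(ε_n : F)² = 1`. [cite: DuncanSchweinhart2025, §2.2] -/
theorem eps_mul_eps_cast (n : Fin 4) : ((eps n : ℤ) : F) * ((eps n : ℤ) : F) = 1 := by
  rw [← Int.cast_mul, eps_mul_eps n, Int.cast_one]

/-- **Dual `1`-cochains as primal `3`-chains**: the dual edge from the dual site `x` in direction `n`
is dual to the primal `3`-cell `(x + e_n; {n}ᶜ)`; a `1`-cochain `θ` of the dual torus becomes the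
`3`-chain `w(y; T) = ε_{n(T)} θ(y - e_{n(T)}, n(T))`, `ε_n = (-1)^n`. A linear equivalence.
[cite: DuncanSchweinhart2025, §2.2 (C^k(dual) ≅ C_{d-k}) and Thm. 14 (proof)] -/
def dualCochainEquiv : (Site 4 L → Fin 4 → F) ≃ₗ[F] (Cell₃ 4 L → F) where
  toFun θ c := ((eps (dirOfTriple c.2) : ℤ) : F) * θ (c.1 - te (dirOfTriple c.2)) (dirOfTriple c.2)
  invFun w x n := ((eps n : ℤ) : F) * w (x + te n, tripleOfDir n)
  map_add' a b := by
    funext c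
    simp only [Pi.add_apply]
    ring
  map_smul' r a := by
    funext c
    simp only [Pi.smul_apply, smul_eq_mul, RingHom.id_apply]
    ring
  left_inv θ := by
    funext x n
    simp only [dirOfTriple_tripleOfDir, add_sub_cancel_right, ← mul_assoc, eps_mul_eps_cast, one_mul]
  right_inv w := by
    funext c
    obtain ⟨y, T⟩ := c
    simp only [tripleOfDir_dirOfTriple, sub_add_cancel, ← mul_assoc, eps_mul_eps_cast, one_mul]

/-- `dualCochainEquiv` unfolded. [cite: DuncanSchweinhart2025, §2.2] -/
theorem dualCochainEquiv_apply (θ : Site 4 L → Fin 4 → F) (c : Cell₃ 4 L) :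
    dualCochainEquiv F θ c =
      ((eps (dirOfTriple c.2) : ℤ) : F) * θ (c.1 - te (dirOfTriple c.2)) (dirOfTriple c.2) := rfl

variable [NeZero L]

/-- **`δ` of the dual complex is `±∂₃`**: for every `1`-cochain `θ` of the dual torus and every
primal plaquette `σ`, `(δθ)(σ•) = t_σ · (∂₃ Ψθ)(σ)` with `t_σ = ±1` depending only on the plane of
`σ` (`Ψ = dualCochainEquiv`, `σ• = dualPlaq σ`). This is the cell-level identity "`[σ• : τ•] = ±[τ : σ]`"
behind the duality of the plaquette random-cluster model on `𝕋⁴_N`.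
[cite: DuncanSchweinhart2025, §2.2 and Thm. 18 (proof: "ω• is distributed as the dual RCM")] -/
theorem res_td₁_dualPlaq (θ : Site 4 L → Fin 4 → F) (σ : Plaquette 4 L) :
    res (td₁ θ) (dualPlaq σ) = ((dualSign σ.2 : ℤ) : F) * bd₃ (dualCochainEquiv F θ) σ := by
  obtain ⟨z, π⟩ := σ
  rw [bd₃_apply_four]
  simp only [dualPlaq_apply, res, complPlane, td₁, dualCochainEquiv_apply, dirOfTriple_tripleOfDir]
  set l : Fin 4 := complLo π.1.1 π.1.2 with hl
  set m : Fin 4 := complHi π.1.1 π.1.2 with hm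
  have h1 : z - te l - te m + te l = z - te m := by abel
  have h2 : z - te l - te m + te m = z - te l := by abel
  have h3 : z - te m - te l = z - te l - te m := by abel
  rw [h1, h2, h3]
  obtain ⟨s1, s2⟩ := dualSign_identities π
  have s1' := congrArg (Int.cast (R := F)) s1
  have s2' := congrArg (Int.cast (R := F)) s2
  push_cast at s1' s2'
  linear_combination (θ (z - te l) l - θ (z - te l - te m) l) * s1' +
    (θ (z - te m) m - θ (z - te l - te m) m) * s2'

/-- `t_σ ≠ 0` in any field (`t_σ = ±1`). [cite: DuncanSchweinhart2025, §2.2] -/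
theorem dualSign_cast_ne_zero (π : Plane) : ((dualSign π : ℤ) : F) ≠ 0 := by
  have h : ∀ π : Plane, dualSign π * dualSign π = 1 := by decide
  intro h0
  have h1 : ((dualSign π * dualSign π : ℤ) : F) = 1 := by rw [h π, Int.cast_one]
  rw [Int.cast_mul, h0, zero_mul] at h1
  exact zero_ne_one h1

/-- Flatness transfers: `(δθ)(σ•) = 0 ↔ (∂₃ Ψθ)(σ) = 0`. [cite: DuncanSchweinhart2025, §2.2 and Thm. 18 (proof)] -/
theorem res_td₁_dualPlaq_eq_zero_iff (θ : Site 4 L → Fin 4 → F) (σ : Plaquette 4 L) :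
    res (td₁ θ) (dualPlaq σ) = 0 ↔ bd₃ (dualCochainEquiv F θ) σ = 0 := by
  rw [res_td₁_dualPlaq, mul_eq_zero, or_iff_right (dualSign_cast_ne_zero F σ.2)]

/-- **The dual configuration** `ω• = {σ• : σ closed}`: the open dual plaquettes are the duals of the
CLOSED primal plaquettes. [cite: DuncanSchweinhart2025, §4.3 (ω•) and Thm. 18] -/
def dualConfig (ω : Finset (Plaquette 4 L)) : Finset (Plaquette 4 L) := ωᶜ.map dualPlaq.toEmbedding

/-- `|ω•| = |ωᶜ|`. [cite: DuncanSchweinhart2025, §4.3] -/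
theorem card_dualConfig (ω : Finset (Plaquette 4 L)) : (dualConfig ω).card = ωᶜ.card :=
  Finset.card_map _

/-- `|(ω•)ᶜ| = |ω|`. [cite: DuncanSchweinhart2025, §4.3] -/
theorem card_compl_dualConfig (ω : Finset (Plaquette 4 L)) : (dualConfig ω)ᶜ.card = ω.card := by
  rw [Finset.card_compl, card_dualConfig, Finset.card_compl]
  have := Finset.card_le_univ ω
  omega

/-- Membership in `ω•`. [cite: DuncanSchweinhart2025, §4.3] -/
theorem dualPlaq_mem_dualConfig {ω : Finset (Plaquette 4 L)} {σ : Plaquette 4 L} :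
    dualPlaq σ ∈ dualConfig ω ↔ σ ∉ ω := by
  rw [dualConfig, Finset.mem_map_equiv, Equiv.symm_apply_apply, Finset.mem_compl]

/-- **`Z¹(P•(ω•)) ≅ W(ω)`**: a `1`-cochain of the dual torus is flat on the open dual plaquettes iff
its `3`-chain `Ψθ` has boundary supported on the open primal plaquettes.
[cite: DuncanSchweinhart2025, Thm. 18 (proof) and Thm. 14 (proof)] -/
theorem mem_flatCochains_dualConfig_iff (ω : Finset (Plaquette 4 L)) (θ : Site 4 L → Fin 4 → F) :
    θ ∈ flatCochains F F (dualConfig ω) ↔ dualCochainEquiv F θ ∈ dualCocycles F ω := by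
  rw [mem_flatCochains, mem_dualCocycles]
  constructor
  · intro h σ hσ
    rw [← res_td₁_dualPlaq_eq_zero_iff]
    exact h _ (dualPlaq_mem_dualConfig.mpr hσ)
  · intro h τ hτ
    obtain ⟨σ, hσ, rfl⟩ := Finset.mem_map.mp hτ
    rw [Finset.mem_compl] at hσ
    show res (td₁ θ) (dualPlaq σ) = 0
    rw [res_td₁_dualPlaq_eq_zero_iff]
    exact h σ hσ

/-- `Ψ` maps `Z¹(P•(ω•))` onto `W(ω)`. [cite: DuncanSchweinhart2025, Thm. 18 (proof)] -/
theorem map_flatCochains_dualConfig (ω : Finset (Plaquette 4 L)) :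
    (flatCochains F F (dualConfig ω)).map
        ((dualCochainEquiv (L := L) F : (Site 4 L → Fin 4 → F) ≃ₗ[F] (Cell₃ 4 L → F)) :
          (Site 4 L → Fin 4 → F) →ₗ[F] (Cell₃ 4 L → F)) =
      dualCocycles F ω := by
  ext w
  rw [Submodule.mem_map]
  constructor
  · rintro ⟨θ, hθ, rfl⟩
    exact (mem_flatCochains_dualConfig_iff F ω θ).mp hθ
  · intro hw
    refine ⟨(dualCochainEquiv F).symm w, ?_, by simp⟩
    rw [mem_flatCochains_dualConfig_iff, LinearEquiv.apply_symm_apply]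
    exact hw

/-- **`dim Z¹(P•(ω•); F) = dim W(ω)`.** [cite: DuncanSchweinhart2025, Thm. 18 (proof) and Thm. 14] -/
theorem finrank_flatCochains_dualConfig (ω : Finset (Plaquette 4 L)) :
    finrank F (flatCochains F F (dualConfig ω)) = finrank F (dualCocycles F ω) := by
  rw [← map_flatCochains_dualConfig F ω, LinearEquiv.finrank_map_eq]

/-- **The dual weight IS the plaquette random-cluster weight of the dual configuration** (up to the
constant `q^{dim B¹}` coming from the cohomological normalisation `q^{b₁}` vs `q^{dim Z¹}`):
`w_{p',q}(ω•) · q^{dim B¹(𝕋⁴)} = dualWeight_{p',q}(ω)`. [cite: DuncanSchweinhart2025, Thm. 18] -/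
theorem weight_dualConfig (p' q : ℝ) (ω : Finset (Plaquette 4 L)) :
    weight F p' q (dualConfig ω) * q ^ finrank F (gradCochains (d := 4) (L := L) F F) =
      dualWeight F p' q ω := by
  unfold weight dualWeight
  rw [card_dualConfig, card_compl_dualConfig, ← finrank_flatCochains_dualConfig F ω,
    ← bettiOne_add_finrank_grad F (dualConfig ω), pow_add]
  ring

/-- **Theorem 18 on `𝕋⁴_L`, literally (the plaquette random-cluster model in four dimensions is
self-dual at `p ↔ p* = (1-p)q/((1-p)q+p)`):** for `p ∈ (0,1)`, `q > 0` there is a constant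
`C = C(p,q,L) > 0` with
`w_{p,q}(ω) · (√q)^{b•(ω)} = C · w_{p*,q}(ω•) · (√q)^{b₂(ω)}` for every plaquette configuration `ω`
of `𝕋⁴_L`, where `ω• = dualConfig ω` is the dual configuration ON THE SAME TORUS, `w` the plaquette
random-cluster weight `p^{|ω|}(1-p)^{|ωᶜ|}q^{b₁(P(ω))}` of the companion file, `b₂ = giantTwo` and
`b• = dualGiant` the balancing giant-cycle ranks. (At `p = p_sd = √q/(1+√q)`, `p* = p`.)
[cite: DuncanSchweinhart2025, Thm. 18 and Thm. 14] -/
theorem duality_balanced_weight_cubical {p q : ℝ} (hp : p ∈ Set.Ioo (0 : ℝ) 1) (hq : 0 < q) :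
    ∃ C : ℝ, 0 < C ∧ ∀ ω : Finset (Plaquette 4 L),
      weight F p q ω * Real.sqrt q ^ dualGiant F ω =
        C * (weight F (dualParam p q) q (dualConfig ω) * Real.sqrt q ^ giantTwo F ω) := by
  obtain ⟨C, hC, h⟩ := duality_balanced_weight (d := 4) (L := L) F hp hq
  refine ⟨C * q ^ finrank F (gradCochains (d := 4) (L := L) F F), mul_pos hC (pow_pos hq _),
    fun ω => ?_⟩
  rw [h ω, ← weight_dualConfig F (dualParam p q) q ω]
  ring

end DualMaps

/-! ### Dual `2`-chains: the twisted pull-back, `2`-cycles of `ω•` and the giant-cycle rank -/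

section DualTwoChains

variable {L : ℕ} (F : Type*) [Field F]

open Dual4

/-- `t_π² = 1` in any field. [cite: DuncanSchweinhart2025, §2.2] -/
theorem dualSign_mul_self_cast (π : Plane) : ((dualSign π : ℤ) : F) * ((dualSign π : ℤ) : F) = 1 := by
  have h : ∀ π : Plane, dualSign π * dualSign π = 1 := by decide
  rw [← Int.cast_mul, h π, Int.cast_one]

/-- `t_{πᶜ} = t_π`. [cite: DuncanSchweinhart2025, §2.2] -/
theorem dualSign_complPlane : ∀ π : Plane, dualSign (complPlane π) = dualSign π := by decide

/-- **Dual `2`-chains as primal plaquette functions** (twisted pull-back along `σ ↦ σ•`):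
`(Φη)(σ) = t_σ η(σ•)`; a linear automorphism of `C₂(𝕋⁴_L; F)`.
[cite: DuncanSchweinhart2025, §2.2 (C^k(dual) ≅ C_{d-k})] -/
def dualPullback : (Plaquette 4 L → F) ≃ₗ[F] (Plaquette 4 L → F) where
  toFun η σ := ((dualSign σ.2 : ℤ) : F) * η (dualPlaq σ)
  invFun ξ τ := ((dualSign (dualPlaq.symm τ).2 : ℤ) : F) * ξ (dualPlaq.symm τ)
  map_add' a b := by
    funext σ
    simp only [Pi.add_apply]
    ring
  map_smul' r a := by
    funext σ
    simp only [Pi.smul_apply, smul_eq_mul, RingHom.id_apply]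
    ring
  left_inv η := by
    funext τ
    simp only [Equiv.apply_symm_apply, ← mul_assoc, dualSign_mul_self_cast, one_mul]
  right_inv ξ := by
    funext σ
    simp only [Equiv.symm_apply_apply, ← mul_assoc, dualSign_mul_self_cast, one_mul]

/-- `dualPullback` unfolded. [cite: DuncanSchweinhart2025, §2.2] -/
theorem dualPullback_apply (η : Plaquette 4 L → F) (σ : Plaquette 4 L) :
    dualPullback F η σ = ((dualSign σ.2 : ℤ) : F) * η (dualPlaq σ) := rfl

/-- `dualPullback⁻¹` at a dual plaquette. [cite: DuncanSchweinhart2025, §2.2] -/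
theorem dualPullback_symm_apply_dualPlaq (ξ : Plaquette 4 L → F) (σ : Plaquette 4 L) :
    (dualPullback F).symm ξ (dualPlaq σ) = ((dualSign σ.2 : ℤ) : F) * ξ σ := by
  show ((dualSign (dualPlaq.symm (dualPlaq σ)).2 : ℤ) : F) * ξ (dualPlaq.symm (dualPlaq σ)) = _
  rw [Equiv.symm_apply_apply]

/-- The all-ones translation vector. [cite: DuncanSchweinhart2025, §2.2 (the dual lattice is the shift by (½,…,½))] -/
def onesVec : Site 4 L := fun _ => 1

/-- **Double dual = shift**: `(σ•)• = σ - (1,1,1,1)`. [cite: DuncanSchweinhart2025, §2.2] -/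
theorem dualPlaq_dualPlaq (z : Site 4 L) (π : Plane) :
    dualPlaq (dualPlaq (z, π)) = (z - onesVec, π) := by
  rw [dualPlaq_apply, dualPlaq_apply]
  refine Prod.ext ?_ (complPlane_complPlane π)
  obtain ⟨⟨a, b⟩, hab⟩ := π
  funext k
  fin_cases a <;> fin_cases b <;> simp (config := {decide := true}) at hab
  all_goals
    fin_cases k <;>
      simp (config := {decide := true}) [complPlane, complLo, complHi, te,
        onesVec, sub_eq_add_neg, add_assoc]

/-- Undo a translation of a `1`-cochain. [cite: DuncanSchweinhart2025, §2.2] -/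
theorem shiftCochain₁_neg_shiftCochain₁ {A : Type*} [AddCommGroup A] (v : Site 4 L)
    (θ : Site 4 L → Fin 4 → A) : shiftCochain₁ (-v) (shiftCochain₁ v θ) = θ := by
  funext x k
  simp [shiftCochain₁]

variable [NeZero L]

/-- **The pairing identity** `⟨δθ, η⟩_{dual} = ⟨Φη, ∂₃Ψθ⟩`: the key identity summed against a dual
`2`-chain. [cite: DuncanSchweinhart2025, §2.2 and Thm. 18 (proof)] -/
theorem pairing₂_res_td₁_eq (θ : Site 4 L → Fin 4 → F) (η : Plaquette 4 L → F) :
    pairing₂ (res (td₁ θ)) η = pairing₂ (dualPullback F η) (bd₃ (dualCochainEquiv F θ)) := by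
  unfold pairing₂
  rw [← dualPlaq.sum_comp]
  refine Finset.sum_congr rfl fun σ _ => ?_
  rw [res_td₁_dualPlaq, dualPullback_apply]
  ring

/-- **`Z₂(P•(ω•)) ≅ K(ω)`**: the `2`-cycles of the dual torus supported on the open dual plaquettes
are, under `Φ`, exactly the `δ₂`-closed plaquette functions supported on the closed primal
plaquettes. [cite: DuncanSchweinhart2025, Thm. 14 (proof: b_i(ω•) via the dual complex) and §3] -/
theorem map_twoCycles_dualConfig (ω : Finset (Plaquette 4 L)) :
    (twoCycles F (dualConfig ω)).map
        ((dualPullback (L := L) F : (Plaquette 4 L → F) ≃ₗ[F] (Plaquette 4 L → F)) :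
          (Plaquette 4 L → F) →ₗ[F] (Plaquette 4 L → F)) =
      dualTopCycles F ω := by
  ext ξ
  rw [Submodule.mem_map, mem_dualTopCycles]
  constructor
  · rintro ⟨η, hη, rfl⟩
    rw [mem_twoCycles] at hη
    obtain ⟨hsupp, hbd⟩ := hη
    refine ⟨fun σ hσ => ?_, ?_⟩
    · show ((dualSign σ.2 : ℤ) : F) * η (dualPlaq σ) = 0
      rw [hsupp _ (fun h => (dualPlaq_mem_dualConfig.mp h) hσ), mul_zero]
    · rw [delta₂_eq_zero_iff_pairing]
      intro w
      have h := (bd₂_eq_zero_iff F η).mp hbd ((dualCochainEquiv F).symm w)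
      rw [pairing₂_res_td₁_eq, LinearEquiv.apply_symm_apply] at h
      exact h
  · rintro ⟨hsupp, hδ⟩
    refine ⟨(dualPullback F).symm ξ, ?_, LinearEquiv.apply_symm_apply _ _⟩
    rw [mem_twoCycles]
    refine ⟨fun τ hτ => ?_, ?_⟩
    · obtain ⟨σ, rfl⟩ := dualPlaq.surjective τ
      rw [dualPullback_symm_apply_dualPlaq,
        hsupp σ (not_not.mp (fun h => hτ (dualPlaq_mem_dualConfig.mpr h))), mul_zero]
    · rw [bd₂_eq_zero_iff]
      intro θ
      rw [pairing₂_res_td₁_eq, LinearEquiv.apply_symm_apply]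
      exact (delta₂_eq_zero_iff_pairing F ξ).mp hδ _

/-- **`∂₃` of the dual complex is `±δ₁`** (the third intertwiner, derived from `res_td₁_dualPlaq` by
double duality): `Φ(∂₃ w•) = δ₁θ̃` with `θ̃ = (Ψ⁻¹w•)(· - (1,1,1,1))`.
[cite: DuncanSchweinhart2025, §2.2 and Thm. 14 (proof)] -/
theorem dualPullback_bd₃ (w : Cell₃ 4 L → F) :
    dualPullback F (bd₃ w) =
      res (td₁ (shiftCochain₁ (-onesVec) ((dualCochainEquiv F).symm w))) := by
  funext σ
  obtain ⟨z, π⟩ := σ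
  rw [dualPullback_apply, td₁_shiftCochain₁]
  have h := res_td₁_dualPlaq F ((dualCochainEquiv F).symm w) (dualPlaq (z, π))
  rw [LinearEquiv.apply_symm_apply, dualPlaq_dualPlaq] at h
  have h2 : (dualPlaq (z, π)).2 = complPlane π := rfl
  rw [h2, dualSign_complPlane] at h
  -- `h : res (td₁ θ) (z - 1, π) = t_π * bd₃ w (dualPlaq (z, π))`
  rw [← h]
  simp only [res, shiftCochain₂, sub_eq_add_neg]

/-- **`Φ(B₂(𝕋⁴)) = B²(𝕋⁴)`**: torus `2`-boundaries of the dual are torus `2`-coboundaries of the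
primal. [cite: DuncanSchweinhart2025, Thm. 14 (proof) and §3] -/
theorem map_bdTwo_dualPullback :
    (bdTwo (d := 4) (L := L) F).map
        ((dualPullback (L := L) F : (Plaquette 4 L → F) ≃ₗ[F] (Plaquette 4 L → F)) :
          (Plaquette 4 L → F) →ₗ[F] (Plaquette 4 L → F)) =
      cobTwo (d := 4) (L := L) F := by
  ext ξ
  simp only [Submodule.mem_map, LinearMap.mem_range, bd₃Lin_apply, delta₁_apply,
    LinearEquiv.coe_coe]
  constructor
  · rintro ⟨η, ⟨w, rfl⟩, rfl⟩
    exact ⟨_, (dualPullback_bd₃ F w).symm⟩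
  · rintro ⟨θ, rfl⟩
    refine ⟨bd₃ (dualCochainEquiv F (shiftCochain₁ onesVec θ)), ⟨_, rfl⟩, ?_⟩
    rw [dualPullback_bd₃, LinearEquiv.symm_apply_apply, shiftCochain₁_neg_shiftCochain₁]

/-- **`b₂(ω•) = b•(ω)`**: the giant-cycle rank of the dual configuration (computed, like `b₂`, on the
torus `𝕋⁴_L` where it lives) is the dual giant rank of the companion file.
[cite: DuncanSchweinhart2025, Thm. 14 (eq. (2)–(3)) and Thm. 18] -/
theorem giantTwo_dualConfig (ω : Finset (Plaquette 4 L)) :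
    giantTwo F (dualConfig ω) = dualGiant F ω := by
  unfold giantTwo dualGiant
  set Φ : (Plaquette 4 L → F) →ₗ[F] (Plaquette 4 L → F) :=
    ((dualPullback (L := L) F : (Plaquette 4 L → F) ≃ₗ[F] (Plaquette 4 L → F)) :
      (Plaquette 4 L → F) →ₗ[F] (Plaquette 4 L → F)) with hΦ
  rw [← LinearEquiv.finrank_map_eq (dualPullback (L := L) F) (twoCycles F (dualConfig ω) ⊔ bdTwo F),
    ← LinearEquiv.finrank_map_eq (dualPullback (L := L) F) (bdTwo (d := 4) (L := L) F),
    Submodule.map_sup, ← hΦ, map_twoCycles_dualConfig, map_bdTwo_dualPullback]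

/-- **Theorem 18 on `𝕋⁴_L` in final form**: for `p ∈ (0,1)`, `q > 0` there is `C = C(p,q,L) > 0` with
`w_{p,q}(ω) · (√q)^{b₂(ω•)} = C · w_{p*,q}(ω•) · (√q)^{b₂(ω)}` for every plaquette configuration `ω`
of `𝕋⁴_L` — the balanced plaquette random-cluster measure at `(p, q)` is the image under `ω ↦ ω•` of
the balanced measure at `(p*, q)`, `p* = (1-p)q/((1-p)q + p)`; at `p_sd = √q/(1+√q)` the model is
self-dual. [cite: DuncanSchweinhart2025, Thm. 18] -/
theorem duality_selfdual_four {p q : ℝ} (hp : p ∈ Set.Ioo (0 : ℝ) 1) (hq : 0 < q) :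
    ∃ C : ℝ, 0 < C ∧ ∀ ω : Finset (Plaquette 4 L),
      weight F p q ω * Real.sqrt q ^ giantTwo F (dualConfig ω) =
        C * (weight F (dualParam p q) q (dualConfig ω) * Real.sqrt q ^ giantTwo F ω) := by
  obtain ⟨C, hC, h⟩ := duality_balanced_weight_cubical (L := L) F hp hq
  exact ⟨C, hC, fun ω => by rw [giantTwo_dualConfig]; exact h ω⟩

end DualTwoChains

end PlaquetteRC

end Literature.MathematicalPhysics.QuantumFieldTheory
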